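import Summits.RiemannHypothesis.RiemannHypothesis.Theses.NbTruncationBarrier
import Summits.RiemannHypothesis.RiemannHypothesis.Theorems.Splittings.NbTruncationD
import HarnessLib

/-!
# Route NbTruncationBarrier (L6) — the RUNG LEAF `NbTruncationBarrier` (T45, L-P(P2′), RH-FREE)

Item stmt-RiemannHypothesis-21761 (`∀ M, FIN_M ↔ M = 1 ∨ M = 2`) is the ∀-closure of the tree theorem
`Summit.RiemannHypothesis.RiemannHypothesis.Theorems.Splittings.NbTruncation.truncFin_iff` (lane (xv-V),
Theorems/Splittings/NbTruncationD.lean §5; its `M > 1000` branch consumes the catalogued barrier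
`TuranPartialSums_holds`, whose `native_decide` certificates enter the axiom closure — filed `--computational`).
One-line closer, cited by name. RH-free proof-of-data about SECTIONS of ζ (the Báez-Duarte criterion does not
survive any truncation `M ≥ 3`); no summit is proved by this; nothing here bears on the truth of RH.
-/

-- D-0017: `Summit.RiemannHypothesis.RiemannHypothesis.…` duplicates the namespace BY DESIGN (single-problem summit).
set_option linter.dupNamespace false

namespace Summit.RiemannHypothesis.RiemannHypothesis.Theorems.NbTruncationBarrier

/-- **Rung leaf `NbTruncationBarrier` (item stmt-RiemannHypothesis-21761) holds**: for every `M`,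
`FIN_M ↔ M ∈ {1, 2}` — the tree theorem `Splittings.NbTruncation.truncFin_iff`, by name. RH-free
(computational closure for `M > 1000`). -/
theorem nbTruncationBarrier_proof :
    Summit.RiemannHypothesis.RiemannHypothesis.Theses.NbTruncationBarrier.NbTruncationBarrier :=
  fun M ↦ Splittings.NbTruncation.truncFin_iff M

end Summit.RiemannHypothesis.RiemannHypothesis.Theorems.NbTruncationBarrier
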